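import Literature.Geometry.Riemannian.SphericalCylinderEntropy
import Literature.Geometry.Riemannian.RoundSphere
import Literature.Geometry.Riemannian.LevelSetMeanCurvature
import Literature.Geometry.Riemannian.GaussianShrinker
import Literature.Geometry.Lorentzian.LeviCivitaProofs
import HarnessLib

/-!
# Route `CylinderEntropy`, crux `CylinderRungTwo` (stmt-SmoothPoincare4-7631):
# vocabulary of the line `killing-flux`

Route-posited objects (D-0016 `<Route>Defs` file) shared by the registered stubs of the checked skeleton
`Cruxes/CylinderRungTwo/Lines/killing-flux.lean` and by the crux file that composes them.  Everything
here is a plain `Set`, a `Prop`-valued PREDICATE with explicit parameters over existing tree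
declarations (`Literature.Geometry.Riemannian.SphericalCylinderEntropy.truncL`,
`Literature.Geometry.Lorentzian.PseudoRiemannianMetric.{IsSpacelikeImmersion, IsUnitNormal,
meanCurvature}`, `Literature.Geometry.Riemannian.euclideanMetric`), or a PROVED theorem; nothing is
asserted and no closed proposition is defined.

* `cylN` — the round cylinder `N = S⁴ × ℝ = {z ∈ ℝ⁶ | ∑_{i<5} zᵢ² = 1}`, spelled as in the route items;
  `SeparatesEnds A` — the items' typed `JoinedIn` end-separation predicate, verbatim (so that the crux
  hypothesis IS `SeparatesEnds (Set.range ι)` by `rfl`).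
* `IsGraphical M ι` — the shadow `truncL ∘ ι : M → ℝ⁵` (drop the height) is an injective immersion.
* `IsCylinderMCF M F ν T` — a smooth mean curvature flow of embedded cross-sections of `N` on
  `[T, ∞)`, typed EXTRINSICALLY in `ℝ⁶`: `F t : M → ℝ⁶` smooth embeddings into `N`, `ν t` a smooth unit
  normal of `Σ_t = F t (M)` normal to `Σ_t` and tangent to `N`, velocity `∂F/∂t = -H ν` with `H` the
  tree's scalar `meanCurvature` of `(F t, ν t)` computed in `ℝ⁶` — which for `ν ⊥ n_N` is the mean
  curvature of `Σ_t ⊂ N` (the second fundamental forms of `Σ_t` in `ℝ⁶` and in `N` differ by a multiple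
  of the radial normal `n_N ⊥ ν`).  This is the flow of Hamilton's monotonicity formula in the ambient
  `N` (Comm. Anal. Geom. 1 (1993) 127–137) and of A. Sun's intrinsic entropy (J. Geom. Anal. 2020).
* PROVED API (non-vacuity of the interface): `heightL`/`gradient_heightL`/`unitGradient_heightL` (the
  height `z₅` and its gradient `e₅`), `contMDiff_sliceMap`, `mfderiv_sliceMap`,
  `mfderiv_sliceMap_injective`, `isSpacelikeImmersion_sliceMap`, **`meanCurvature_sliceMap`** (slices are
  minimal: `H = 0`, from the tree's level-set formula for the linear height), and
  **`isCylinderMCF_staticSlice`** — the static slice `F t = sliceMap c`, `ν t = e₅` is a cylinder flow on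
  every `[T, ∞)`, so the hypotheses of the analytic stubs of the line are satisfiable.

Authorship: the block is the planner's (planner-cruxplan-stmt-SmoothPoincare4-7631-killing-flux-0,
skeleton round 1), moved here verbatim by the line lead so that landed stub files can import it.

References: R. S. Hamilton, *Monotonicity formulas for parabolic flows on manifolds*, Comm. Anal. Geom.
1 (1993) 127–137; A. Sun, *Entropy in a closed manifold and partial regularity of mean curvature flow
limit of surfaces*, J. Geom. Anal. 31 (2021), arXiv:1912.09431, Def. 1.1; B. O'Neill,
*Semi-Riemannian Geometry* (1983), Ch. 4 (hypersurface conventions of the tree).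
-/

noncomputable section

-- the prescribed namespace repeats `SmoothPoincare4` (P = Sub)
set_option linter.dupNamespace false

open MeasureTheory Set
open scoped Manifold ContDiff ENNReal Topology BigOperators RealInnerProductSpace Gradient

namespace Summit.SmoothPoincare4.SmoothPoincare4.Cruxes.CylinderRungTwo.KillingFlux

open Literature.Geometry.Riemannian
open Literature.Geometry.Lorentzian Literature.Geometry.Lorentzian.PseudoRiemannianMetric
open Literature.Geometry.Riemannian.SphericalCylinderEntropy (truncL)

local notation "E4" => EuclideanSpace ℝ (Fin 4)
local notation "E5" => EuclideanSpace ℝ (Fin 5)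
local notation "E6" => EuclideanSpace ℝ (Fin 6)

/-! ## The objects -/

/-- The round cylinder `N = S⁴ × ℝ ⊂ ℝ⁶`, exactly as typed in the route items. [folklore] -/
def cylN : Set E6 := {z | ∑ i : Fin 5, z (Fin.castSucc i) ^ 2 = 1}

/-- The typed end-separation predicate of the route items: no path in `N ∖ A` from height `≤ -R` to
height `≥ R`. [folklore] -/
def SeparatesEnds (A : Set E6) : Prop :=
  ∃ R : ℝ, ∀ a b : E6, ∑ i : Fin 5, a (Fin.castSucc i) ^ 2 = 1 → ∑ i : Fin 5, b (Fin.castSucc i) ^ 2 = 1 →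
    a 5 ≤ -R → R ≤ b 5 → ¬ JoinedIn (cylN \ A) a b

/-- `ι : M → N` is GRAPHICAL over the slices: its shadow `truncL ∘ ι : M → ℝ⁵` (drop the height
coordinate; tree `truncL`, 1-Lipschitz) is an injective immersion. For a connected compact
cross-section with unit normal `ν` in `N` this says: the vertical angle `u = ⟪ν, e₅⟫` never vanishes
(immersion) and the shadow has one sheet (injective). [folklore] -/
def IsGraphical (M : Type) [TopologicalSpace M] [ChartedSpace E4 M] (ι : M → E6) : Prop :=
  Function.Injective ((truncL : E6 → E5) ∘ ι) ∧
    ∀ x : M, Function.Injective (mfderiv (𝓡 4) (𝓡 5) ((truncL : E6 → E5) ∘ ι) x)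

/-- **A smooth mean curvature flow of embedded cross-sections of `N = S⁴ × ℝ` on `[T, ∞)`**, written
extrinsically in `ℝ⁶` with the tree's hypersurface vocabulary (`Lorentzian/Hypersurface.lean`; the
tree's `IsClassicalMCF` is dimension-locked to hypersurfaces of the ambient manifold, and a
cross-section has codimension 2 in `ℝ⁶`). Data: `F t : M → ℝ⁶` the embeddings and `ν t : M → ℝ⁶` the
unit normal of `Σ_t = F t (M)` INSIDE `N`: normal to `Σ_t` (`IsUnitNormal`) and tangent to `N`
(`normal_tangent`: orthogonal to the radial normal `n = (z', 0)` of `N`). Since `ν ⊥ n`, the tree's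
scalar `meanCurvature (F t) _ _ (ν t) x = tr_{F_t^*δ} ⟨D ν, dF⟩` computed in `ℝ⁶` IS the mean
curvature `H_N` of `Σ_t ⊂ N` with respect to `ν` (the `ℝ⁶`- and `N`-second fundamental forms of `Σ_t`
differ by a multiple of `n ⊥ ν`), and `∂F/∂t = -H_N ν` is mean curvature flow in the Riemannian
manifold `N` (tree sign convention: round spheres with the outward normal have `H > 0` and shrink; the
vector `-H ν` does not depend on the sign of `ν`); this is the flow of Hamilton's monotonicity formula
(Comm. Anal. Geom. 1 (1993) 127–137, doi:10.4310/cag.1993.v1.n1.a7) in the ambient `N`. Non-vacuous: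
the static slice `F t = sliceMap c`, `ν t = e₅` (`H = 0`, `isCylinderMCF_staticSlice` below). [folklore] -/
structure IsCylinderMCF (M : Type) [TopologicalSpace M] [ChartedSpace E4 M] [IsManifold (𝓡 4) ∞ M]
    (F : ℝ → M → E6) (ν : ℝ → M → E6) (T : ℝ) : Prop where
  /-- The family is jointly smooth on `U × M` for some open `U ⊇ [T, ∞)`. -/
  contMDiffOn : ∃ U : Set ℝ, IsOpen U ∧ Set.Ici T ⊆ U ∧
    ContMDiffOn (𝓘(ℝ, ℝ).prod (𝓡 4)) (𝓡 6) ∞ (fun p : ℝ × M => F p.1 p.2) (U ×ˢ Set.univ)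
  /-- Each `F t`, `t ≥ T`, is a smooth embedding (the cross-sections are embedded). -/
  isSmoothEmbedding : ∀ t, T ≤ t → Manifold.IsSmoothEmbedding (𝓡 4) (𝓡 6) ∞ (F t)
  /-- Each `F t`, `t ≥ T`, lands in the cylinder `N`. -/
  mem_cyl : ∀ t, T ≤ t → ∀ x, ∑ i : Fin 5, F t x (Fin.castSucc i) ^ 2 = 1
  /-- Each `F t`, `t ≥ T`, is a (spacelike =) immersion for the Euclidean metric, so that the tree's
  induced metric and mean curvature apply (implied by `isSmoothEmbedding`; kept as data of the
  interface). -/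
  isSpacelikeImmersion : ∀ t, T ≤ t → (euclideanMetric E6).IsSpacelikeImmersion (𝓡 4) (F t)
  /-- `ν t` is a unit normal along `F t`: `⟪ν, dF v⟫ = 0` for all `v` and `‖ν‖ = 1`. -/
  isUnitNormal : ∀ t, T ≤ t → (euclideanMetric E6).IsUnitNormal (𝓡 4) (F t) (ν t) 1
  /-- `ν t x` is tangent to `N` at `F t x` (orthogonal to the radial normal `(z', 0)` of `N`). -/
  normal_tangent : ∀ t, T ≤ t → ∀ x, ∑ i : Fin 5, ν t x (Fin.castSucc i) * F t x (Fin.castSucc i) = 0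
  /-- Each `ν t` is smooth. -/
  contMDiff_normal : ∀ t, T ≤ t → ContMDiff (𝓡 4) (𝓡 6) ∞ (ν t)
  /-- The flow equation `∂F/∂t = -H_N ν` on `[T, ∞)`. -/
  velocity_eq : ∀ t (ht : T ≤ t) (x : M),
    mfderiv 𝓘(ℝ, ℝ) (𝓡 6) (fun s => F s x) t (1 : ℝ) =
      -((euclideanMetric E6).meanCurvature (F t) contMDiff_pullbackBilin_holds
          (isSpacelikeImmersion t ht) (ν t) x) • ν t x


/-! ## Non-vacuity of the interface: the static slice is a cylinder flow -/

section StaticSlice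

open Literature.Geometry.Manifold.CylinderSlice

set_option hygiene false in
local notation "S4" => Metric.sphere (0 : EuclideanSpace ℝ (Fin 5)) 1

/-- The height `z ↦ z₅ = ⟪e₅, z⟫` as a continuous linear functional on `ℝ⁶`. [folklore] -/
def heightL : E6 →L[ℝ] ℝ := innerSL ℝ (axis : E6)

/-- `heightL z = ⟪e₅, z⟫`. [folklore] -/
theorem heightL_apply (z : E6) : heightL z = ⟪axis, z⟫ := rfl

/-- `heightL z = z₅`. [folklore] -/
theorem heightL_apply' (z : E6) : heightL z = z 5 := by
  rw [heightL_apply, axis, EuclideanSpace.inner_single_left]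
  simp

/-- `∇ z₅ = e₅`. [folklore] -/
theorem gradient_heightL (z : E6) : ∇ (heightL : E6 → ℝ) z = axis := by
  refine ext_inner_right ℝ fun v => ?_
  rw [inner_gradient_eq_fderiv, ContinuousLinearMap.fderiv, heightL_apply]

/-- The unit gradient of the height is the constant field `e₅`. [folklore] -/
theorem unitGradient_heightL (z : E6) : unitGradient (heightL : E6 → ℝ) z = axis := by
  rw [unitGradient, gradient_heightL]
  simp [axis]

/-- The slice embedding is `C^m` for every `m`. [folklore] -/
theorem contMDiff_sliceMap (c : ℝ) {m : ℕ∞ω} : ContMDiff (𝓡 4) (𝓡 6) m (sliceMap c) := by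
  haveI : Fact (Module.finrank ℝ E5 = 4 + 1) := ⟨finrank_euclideanSpace_fin⟩
  have hA : ContDiff ℝ m (fun y : E5 => padL y + c • axis) := padL.contDiff.add contDiff_const
  have hval : ContMDiff (𝓡 4) 𝓘(ℝ, E5) m (Subtype.val : S4 → E5) := contMDiff_coe_sphere
  rw [sliceMap_eq_comp]
  exact hA.comp_contMDiff hval

/-- The differential of the slice embedding is `padL ∘ dι` (`ι : S⁴ ↪ ℝ⁵`). [folklore] -/
theorem mfderiv_sliceMap (c : ℝ) (x : S4) :
    mfderiv (𝓡 4) (𝓡 6) (sliceMap c) x =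
      padL.comp (mfderiv (𝓡 4) 𝓘(ℝ, E5) (Subtype.val : S4 → E5) x) := by
  haveI : Fact (Module.finrank ℝ E5 = 4 + 1) := ⟨finrank_euclideanSpace_fin⟩
  have hval : ContMDiff (𝓡 4) 𝓘(ℝ, E5) ∞ (Subtype.val : S4 → E5) := contMDiff_coe_sphere
  have h1 : HasMFDerivAt (𝓡 4) 𝓘(ℝ, E5) (Subtype.val : S4 → E5) x
      (mfderiv (𝓡 4) 𝓘(ℝ, E5) (Subtype.val : S4 → E5) x) :=
    ((hval x).mdifferentiableAt (by simp)).hasMFDerivAt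
  have h2 : HasFDerivAt (fun y : E5 => padL y + c • axis) padL (x : E5) :=
    padL.hasFDerivAt.add_const _
  have h3 := h2.hasMFDerivAt.comp x h1
  rw [sliceMap_eq_comp]
  exact h3.mfderiv

/-- Tangent vectors of a slice are horizontal: `⟪e₅, d(sliceMap) w⟫ = 0` (stated with Mathlib's
vector-valued `mvfderiv`, definitionally `mfderiv`). [folklore] -/
theorem heightL_mvfderiv_sliceMap (c : ℝ) (x : S4) (w : TangentSpace (𝓡 4) x) :
    heightL (mvfderiv (𝓡 4) (sliceMap c) x w) = 0 := by
  have h : mvfderiv (𝓡 4) (sliceMap c) x w =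
      padL (mvfderiv (𝓡 4) (Subtype.val : S4 → E5) x w) :=
    DFunLike.congr_fun (mfderiv_sliceMap c x) w
  rw [h, heightL_apply']
  exact padL_apply_last _

/-- The differential of the slice embedding is injective. [folklore] -/
theorem mfderiv_sliceMap_injective (c : ℝ) (x : S4) :
    Function.Injective (mfderiv (𝓡 4) (𝓡 6) (sliceMap c) x) := by
  haveI : Fact (Module.finrank ℝ E5 = 4 + 1) := ⟨finrank_euclideanSpace_fin⟩
  rw [mfderiv_sliceMap]
  exact padL_injective.comp (mfderiv_coe_sphere_injective x)

/-- The slice embedding is a (spacelike =) immersion for the Euclidean metric. [folklore] -/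
theorem isSpacelikeImmersion_sliceMap (c : ℝ) :
    (euclideanMetric E6).IsSpacelikeImmersion (𝓡 4) (sliceMap c) := by
  refine ⟨contMDiff_sliceMap c, fun y v hv => ?_⟩
  -- the tangent spaces of `ℝ⁶` are `ℝ⁶`; Mathlib deliberately provides no normed instances on
  -- `TangentSpace`, so we install the definitional ones locally (tree idiom, `TimeCones.lean`)
  letI : NormedAddCommGroup (TangentSpace (𝓡 6) (sliceMap c y)) :=
    inferInstanceAs (NormedAddCommGroup E6)
  letI : InnerProductSpace ℝ (TangentSpace (𝓡 6) (sliceMap c y)) :=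
    inferInstanceAs (InnerProductSpace ℝ E6)
  rw [inducedBilin_apply, euclideanMetric_apply]
  have hne : mfderiv (𝓡 4) (𝓡 6) (sliceMap c) y v ≠ 0 := fun h =>
    hv (mfderiv_sliceMap_injective c y (by rw [h, map_zero]))
  exact real_inner_self_pos.mpr hne

/-- **Slices are minimal**: the mean curvature of `sliceMap c` with respect to the normal `e₅` is `0`
(the slice is a level set of the LINEAR height function `z₅`, tree formula
`meanCurvature_unitGradient_eq_sum`: `H = ‖∇F‖⁻¹ ∑ Hess F(vᵢ, vᵢ) = 0`). [folklore] -/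
theorem meanCurvature_sliceMap (c : ℝ)
    (hf : (euclideanMetric E6).IsSpacelikeImmersion (𝓡 4) (sliceMap c)) (y : S4) :
    (euclideanMetric E6).meanCurvature (sliceMap c) contMDiff_pullbackBilin_holds hf
      (fun _ => axis) y = 0 := by
  haveI : Fact (Module.finrank ℝ E5 = 4 + 1) := ⟨finrank_euclideanSpace_fin⟩
  have hFl : ContDiff ℝ ∞ (heightL : E6 → ℝ) := heightL.contDiff
  have hy : (𝓡 4).IsInteriorPoint y := BoundarylessManifold.isInteriorPoint
  have hx : ∇ (heightL : E6 → ℝ) (sliceMap c y) ≠ 0 := by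
    rw [gradient_heightL]
    simp [axis]
  have hdF : ∀ w : TangentSpace (𝓡 4) y,
      fderiv ℝ (heightL : E6 → ℝ) (sliceMap c y) (mfderiv (𝓡 4) 𝓘(ℝ, E6) (sliceMap c) y w) = 0 := by
    intro w
    rw [ContinuousLinearMap.fderiv]
    exact heightL_mvfderiv_sliceMap c y w
  have hν : (fun z : S4 => (unitGradient (heightL : E6 → ℝ) (sliceMap c z) : E6)) = fun _ => axis := by
    funext z
    exact unitGradient_heightL _
  obtain ⟨b, -, -, hH⟩ := meanCurvature_unitGradient_eq_sum (W := E6) (I' := 𝓡 4) hFl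
    contMDiff_pullbackBilin_holds hf hy hx hdF (finrank_euclideanSpace_fin (𝕜 := ℝ) (n := 4))
  rw [hν] at hH
  rw [hH]
  have hfd : fderiv ℝ (heightL : E6 → ℝ) = fun _ => heightL := by
    funext z
    exact ContinuousLinearMap.fderiv heightL
  have h2 : ∀ a a' : E6, iteratedFDeriv ℝ 2 (heightL : E6 → ℝ) (sliceMap c y) ![a, a'] = 0 := by
    intro a a'
    rw [iteratedFDeriv_two_apply, hfd, fderiv_fun_const]
    rfl
  simp [h2]

/-- **The interface `IsCylinderMCF` is inhabited**: the static slice at height `c` with the upward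
normal `e₅` is a smooth mean curvature flow of embedded cross-sections on every `[T, ∞)`
(`∂F/∂t = 0 = -H e₅` since slices are minimal). [folklore] -/
theorem isCylinderMCF_staticSlice (c T : ℝ) :
    IsCylinderMCF S4 (fun _ => sliceMap c) (fun _ _ => axis) T where
  contMDiffOn := ⟨Set.univ, isOpen_univ, Set.subset_univ _,
    ((contMDiff_sliceMap c).comp contMDiff_snd).contMDiffOn⟩
  isSmoothEmbedding _ _ := isSmoothEmbedding_sliceMap c
  mem_cyl _ _ x := sum_sq_sliceMap c x
  isSpacelikeImmersion _ _ := isSpacelikeImmersion_sliceMap c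
  isUnitNormal _ _ := by
    refine ⟨fun y v => ?_, fun y => ?_⟩
    · rw [euclideanMetric_apply]
      exact heightL_mvfderiv_sliceMap c y v
    · rw [euclideanMetric_apply]
      change ⟪axis, axis⟫ = (1 : ℝ)
      simp [axis]
  normal_tangent _ _ x := by simp [axis, castSucc_ne_five]
  contMDiff_normal _ _ := contMDiff_const
  velocity_eq t _ x := by
    rw [meanCurvature_sliceMap, neg_zero, zero_smul]
    show mfderiv 𝓘(ℝ, ℝ) (𝓡 6) (fun _ : ℝ => sliceMap c x) t 1 = 0
    rw [mfderiv_const]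
    rfl

/-- **Registered anchor `stub_isCylinderMCF_staticSlice` (non-vacuity of the line's flow interface).**
For every height `c` and every initial time `T`, the static slice `t ↦ sliceMap c` with the constant
upward unit normal `e₅` is a smooth mean curvature flow of embedded cross-sections of `N = S⁴ × ℝ` on
`[T, ∞)` in the sense of `IsCylinderMCF` (slices are minimal, `meanCurvature_sliceMap`).  This is the
registered stub through which this vocabulary file lands `--supports stmt-SmoothPoincare4-7631`; it is
what makes the hypotheses of the analytic stubs of line `killing-flux` satisfiable. [folklore] -/
theorem stub_isCylinderMCF_staticSlice :
    ∀ c T : ℝ, IsCylinderMCF (Metric.sphere (0 : EuclideanSpace ℝ (Fin 5)) 1)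
      (fun _ => Literature.Geometry.Manifold.CylinderSlice.sliceMap c)
      (fun _ _ => Literature.Geometry.Manifold.CylinderSlice.axis) T :=
  fun c T => isCylinderMCF_staticSlice c T

end StaticSlice

end Summit.SmoothPoincare4.SmoothPoincare4.Cruxes.CylinderRungTwo.KillingFlux

end
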